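import Summits.BirchSwinnertonDyer.Rank1Residual.Additive.RationalClassesToLayerZero
import Summits.BirchSwinnertonDyer.Rank1Residual.X11b.PrimaryInclusionLevels
import Literature.NumberTheory.EllipticCurves.KummerSelmerStructure
import Literature.NumberTheory.EllipticCurves.IwasawaSelmerControlLocalizationProofs
import Literature.NumberTheory.GaloisRepresentations.LocalGlobalCohomologyDualityProofs
import HarnessLib

/-!
# From `H¹(K, E[p^m])` to LEVEL 0 of a `ℤ_p`-tower: the map `Ψ_m = res_{K_0} ∘ (E[p^m] ↪ E[p^∞])_*`,
# its kernel / image, and the LOCAL COMMUTATION with the level-`0` local restrictions — the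
# vocabulary BRIDGE between Selmer structures on `E[p^m]` and the groups `A_0 = h_0⁻¹(Sel_∞)` of
# the `ℤ_p`-tower files, part 1 (cell `b2b-bsdres`, CLASS-CLOSURE lane, class O10 — x1b GEN 38,
# class lead; file 71 of the series)

HONEST FRAMING (cell `b2b-bsdres`, run/shared/lean/b2b/bsd-rank1-residual/, verbatim in every
file): the goal of the cell is to DELETE the COMBINATION-SHAPED residual classes of the
Birch–Swinnerton-Dyer formula for ALL analytic-rank `≤ 1` elliptic curves over `ℚ` — "full BSD
formula for every rank `≤ 1` curve in class `C`" assembled STRICTLY from published theorems — so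
that the rank-`≤ 1` remainder becomes exactly the CONSTRUCTION-SHAPED classes, which are TYPED
(missing-input `Prop`s), NOT attempted. This is not "finishing BSD". CLASS-CLOSURE lane: prove
what is provable now; shrink each hard class to its core with data; no claim beyond stated classes;
research routes on CONSTRUCTION-SHAPED X12 / O10; census / instrument output = EVIDENCE / conjecture
items, NEVER a Literature fact; `RESIDUAL-MAP.md` marks change only by signed lines. THIS FILE:
TOOL THEOREMS ONLY — no definition, no named Literature fact, no Summits-side fact `def … : Prop`,
no `sorry`, axioms standard; pure Galois-cohomology bookkeeping over ANY field / number field `K`,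
any prime `p`, any `ℤ_p`-extension `κ`, any level `p^m`; nothing is booked; no label / mark / count
/ sub-cell moves; (C1_η), (C2_η-GZ), (C3_η) stay typed as filed (cc-typer-6's pen); O10 stays OPEN /
CONSTRUCTION-SHAPED; nothing about `BSD(W, p)` of any pair is claimed.

## Why

The count (C) at finite level (files 63, 68, 69, 70) computes `[H¹_𝓖(K, E[p^m]) : H¹_𝓕(K, E[p^m])]`
for SELMER STRUCTURES `𝓕 ≤ 𝓖` on the finite module `E[p^m]` (`DiscreteGaloisModule.SelmerStructure`
on `W.torsionGaloisModule (p^m)`, local conditions in `H¹(K_v, E[p^m])`).  The object of the (C3_η)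
derivation is `#(A₀ ⧸ S₀)` for subgroups `S₀ ≤ A₀ ≤ H¹(K_0, E[p^∞])` of the LEVEL-`0` cohomology of a
`ℤ_p`-tower (`W.subgroupH1 p (κ.layerSubgroup 0)`), cut out by conditions on the restriction
`h_0 : H¹(K_0, E[p^∞]) → H¹(K_∞, E[p^∞])` (`A₀ ⊆ W.selmerInftyPreimage κ 0`, files 42–59).  This file
is the first half of the BRIDGE between the two vocabularies (gen 37 NEXT (1)): the map

  `Ψ_m := res_{Γ_K → κ⁻¹(p⁰ℤ_p)} ∘ (E[p^m] ↪ E[p^∞])_* : H¹(K, E[p^m]) → H¹(K_0, E[p^∞])`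

(X11b `Levels.primaryInclusion W p m` followed by `resH1Hom (subgroupIncl (κ.layerSubgroup 0)) id`;
the level-`p` case is n1011's `RationalClassesToLayerZero`), written out in every statement (no
definition is introduced).  Contents (all kernel theorems):
* §1 `Ψ_m` is INJECTIVE when `E[p^∞]^{Γ_K} = 0` (X11b `map_primaryInclusion_injective` + n1011
  `resH1Hom_layerSubgroup_zero_injective`); `p^m · Ψ_m c = 0`; and for `W` elliptic (granted the
  divisibility of `E(K̄)`) **`range Ψ_m = H¹(K_0, E[p^∞])[p^m]`**
  (`exists_levelToLayerZero_eq_of_nsmul_eq_zero`, X11b `mem_range_map_primaryInclusion_iff` +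
  `bijective_resH1Hom_subgroupIncl`).
* §2 **LOCAL COMMUTATION** at any `K`-field `E` (a completion): the level-`0` local restriction
  `loc_{E,0} : H¹(K_0, E[p^∞]) → H¹((Γ_E → Γ_K)⁻¹(κ⁻¹ℤ_p), E(K̄_E))` of `Ψ_m c` is
  `θ_E (res_E c)`, where `res_E : H¹(K, E[p^m]) → H¹(Γ_E, E[p^m])` is the restriction of the
  `GaloisRepresentations` library (`galoisCohomology.res`; at `E = K_v` this IS the localisation
  `galoisCohomology.localization … v`) and
  `θ_E := resH1Hom (subgroupIncl ·) id ∘ (E[p^m](K̄) ↪ E(K̄) → E(K̄_E))_*`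
  (`galoisCohomology.map (W.torsionPointsMapIntertwining (p^m) E) 1`, whose kernel is the local
  KUMMER condition `W.kummerLocalConditionAt (p^m) E`) — `localResOver_levelToLayerZero`.
* §3 the LEVEL-`∞` ("tower") local condition read at level `m`: `h_0 (Ψ_m c)` dies in
  `H¹((Γ_E → Γ_K)⁻¹(ker κ), E(K̄_E))` iff `θ_E (res_E c)` lies in the local tower kernel
  `𝒦_{E,0} = W.localTowerKer κ E 0` (`layerToInfty_levelToLayerZero_mem_localKerOver_iff`); the
  Kummer condition implies it (`θ_E = 0` on `𝓚_E`); conversely, where `𝒦_{E,0}[p^∞] = 0` the tower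
  condition IS the Kummer condition (`mem_kummerLocalConditionAt_of_mem_localTowerKer`); at an
  archimedean place `𝒦_{w,0} = 0` for every `ℤ_p`-extension.
* §4 GLOBAL: **`Ψ_m c ∈ A_0 = h_0⁻¹(Sel_{p^∞}(E/K_∞))` iff `θ_v (loc_v c) ∈ 𝒦_{v,0}` at every finite
  place and `loc_w c ∈ 𝓚_w` (Kummer) at every infinite place**
  (`levelToLayerZero_mem_selmerInftyPreimage_iff`).

References: [GreenbergLNM1716] §2 pp. 62–63, §3 pp. 85–86, §5 p. 114; Mazur–Rubin, *Kolyvagin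
systems* (2004) Def. 2.1.1; [SerreGaloisCohomology1997] I.§2.4, II.§1.1.
-/

noncomputable section

open scoped Classical

open WeierstrassCurve Literature.NumberTheory.EllipticCurves Literature.NumberTheory.GaloisRepresentations
  NumberField IsDedekindDomain Field
open Summit.BirchSwinnertonDyer.Rank1Residual.X11b.Levels
open scoped ContRepresentation

namespace Summit.BirchSwinnertonDyer.Rank1Residual.Additive.LevelBridge

universe u

/-! ### §1 `Ψ_m`: injectivity, exponent, image -/

section Map

variable {K : Type u} [Field K] (W : WeierstrassCurve K) (p : ℕ) [hp : Fact p.Prime]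
  (κ : ZpExtension K p) (m : ℕ)

/-- **`Ψ_m` is injective when `E[p^∞]^{Γ_K} = 0`** (e.g. `E(K)[p] = 0`): `(E[p^m] ↪ E[p^∞])_*` is
injective on `H¹(K, ·)` (X11b `map_primaryInclusion_injective`) and so is `res : H¹(Γ_K, ·) →
H¹(κ⁻¹(ℤ_p), ·)` (`κ⁻¹(ℤ_p) = Γ_K`). [cite: GreenbergLNM1716, §2 p. 63 and §5 p. 114] -/
theorem levelToLayerZero_injective
    (hΓ : ∀ Q : W.geomPrimaryTorsion p,
      (∀ σ : absoluteGaloisGroup K, X11b.LocBridge.primaryGaloisModule W p σ Q = Q) → Q = 0) :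
    Function.Injective fun c : galoisCohomology (W.torsionGaloisModule ((p ^ m : ℕ) : ℤ)) 1 ↦
      resH1Hom (subgroupIncl (κ.layerSubgroup 0)) (AddMonoidHom.id (geomPrimaryTorsion W p))
        (fun _ _ ↦ rfl) (galoisCohomology.map (primaryInclusion W p m) 1 c) :=
  (resH1Hom_layerSubgroup_zero_injective W p κ).comp (map_primaryInclusion_injective W p m hΓ)

omit hp in
/-- Every class of `H¹(K, E[p^m])` is killed by `p^m` (its cocycles take values in `E[p^m]`).
[folklore] -/
theorem pow_smul_galoisCohomology_torsion_eq_zero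
    (c : galoisCohomology (W.torsionGaloisModule ((p ^ m : ℕ) : ℤ)) 1) : p ^ m • c = 0 :=
  galoisCohomology.nsmul_eq_zero_of_forall _ (pow_nsmul_geomTorsion_eq_zero W p m) c

/-- `p^m · Ψ_m c = 0`. [folklore] -/
theorem pow_smul_levelToLayerZero_eq_zero
    (c : galoisCohomology (W.torsionGaloisModule ((p ^ m : ℕ) : ℤ)) 1) :
    p ^ m • resH1Hom (subgroupIncl (κ.layerSubgroup 0)) (AddMonoidHom.id (geomPrimaryTorsion W p))
        (fun _ _ ↦ rfl) (galoisCohomology.map (primaryInclusion W p m) 1 c) = 0 := by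
  have h0 : p ^ m • galoisCohomology.map (primaryInclusion W p m) 1 c = 0 := by
    rw [← map_nsmul, pow_smul_galoisCohomology_torsion_eq_zero, map_zero]
  -- the two libraries' (definitionally equal) group structures on `H¹(K, E[p^∞])` meet here: cross
  -- by `calc`/`exact`, not by `rw`
  calc p ^ m • resH1Hom (subgroupIncl (κ.layerSubgroup 0)) (AddMonoidHom.id (geomPrimaryTorsion W p))
          (fun _ _ ↦ rfl) (galoisCohomology.map (primaryInclusion W p m) 1 c)
      = resH1Hom (subgroupIncl (κ.layerSubgroup 0)) (AddMonoidHom.id (geomPrimaryTorsion W p))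
          (fun _ _ ↦ rfl) (p ^ m • galoisCohomology.map (primaryInclusion W p m) 1 c) :=
        (map_nsmul _ _ _).symm
    _ = 0 := by rw [h0]; exact map_zero _

/-- **`range Ψ_m = H¹(K_0, E[p^∞])[p^m]`** for `W` elliptic (granted the divisibility of `E(K̄)`):
every class `z` of `H¹(K_0, E[p^∞])` with `p^m z = 0` is `Ψ_m c` for some `c ∈ H¹(K, E[p^m])`
(`res` is bijective, `bijective_resH1Hom_subgroupIncl`; the image of `(E[p^m] ↪ E[p^∞])_*` is the
`p^m`-torsion, X11b `mem_range_map_primaryInclusion_iff`). [cite: GreenbergLNM1716, §5 proof of Prop. 5.8] -/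
theorem exists_levelToLayerZero_eq_of_nsmul_eq_zero [W.IsElliptic]
    (hdiv : W.zsmul_geomPoints_surjective) (z : W.subgroupH1 p (κ.layerSubgroup 0))
    (hz : p ^ m • z = 0) :
    ∃ c : galoisCohomology (W.torsionGaloisModule ((p ^ m : ℕ) : ℤ)) 1,
      resH1Hom (subgroupIncl (κ.layerSubgroup 0)) (AddMonoidHom.id (geomPrimaryTorsion W p))
        (fun _ _ ↦ rfl) (galoisCohomology.map (primaryInclusion W p m) 1 c) = z := by
  obtain ⟨x, rfl⟩ := (bijective_resH1Hom_subgroupIncl (geomPrimaryTorsion W p) (κ.layerSubgroup 0)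
    (mem_layerSubgroup_zero p κ)).surjective z
  have hx : p ^ m • x = 0 := by
    apply (bijective_resH1Hom_subgroupIncl (geomPrimaryTorsion W p) (κ.layerSubgroup 0)
      (mem_layerSubgroup_zero p κ)).injective
    rw [map_nsmul, map_zero]
    exact hz
  obtain ⟨c, hc⟩ := (mem_range_map_primaryInclusion_iff W p m hdiv x).mpr hx
  exact ⟨c, by rw [hc]⟩

end Map

/-! ### §2 Local commutation at a `K`-field `E` -/

section Local

variable {K : Type u} [Field K] (W : WeierstrassCurve K) (p : ℕ) [hp : Fact p.Prime]
  (κ : ZpExtension K p) (m : ℕ) (E : Type u) [Field E] [Algebra K E]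

omit hp in
/-- The change of coefficients `E[p^m] ↪ E[p^∞]` commutes with the local restriction into the
cohomology of the local points: `(Γ_E → Γ_K, E[p^∞] ↪ E(K̄) → E(K̄_E))_* ∘ (E[p^m] ↪ E[p^∞])_* =
(Γ_E → Γ_K, E[p^m] ↪ E(K̄) → E(K̄_E))_*` on `H¹(K, E[p^m])` (both send `[φ]` to
`[pointsMap ∘ φ ∘ res]`). [folklore] -/
theorem resH1Hom_pointsMap_map_primaryInclusion
    (c : galoisCohomology (W.torsionGaloisModule ((p ^ m : ℕ) : ℤ)) 1) :
    resH1Hom (resGal (K := K) E) ((pointsMap W E).comp (geomPrimaryTorsion W p).subtype)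
        (W.pointsMap_comp_subtype_smul p) (galoisCohomology.map (primaryInclusion W p m) 1 c) =
      resH1Hom (resGal (K := K) E) ((pointsMap W E).comp (geomTorsion W ((p ^ m : ℕ) : ℤ)).subtype)
        (W.pointsMap_comp_torsion_subtype_smul ((p ^ m : ℕ) : ℤ) E) c := by
  obtain ⟨φ, rfl⟩ := oneCocycleClass_surjective _ c
  rw [galoisCohomology.map_one_oneCocycleClass]
  erw [map_oneCocycleClass, map_oneCocycleClass]
  rfl

/-- **LOCAL COMMUTATION.** For `c ∈ H¹(K, E[p^m])` and a `K`-field `E`, the level-`0` local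
restriction of `Ψ_m c` at `E` is `θ_E (res_E c)`:
`loc_{E,0} (Ψ_m c) = resH1Hom (subgroupIncl H_{E,0}) id ((E[p^m] → E(K̄_E))_* (res_E c))`, where
`H_{E,0} = (Γ_E → Γ_K)⁻¹(κ⁻¹ℤ_p)` (`localSubgroup (κ.layerSubgroup 0) E`, all of `Γ_E` as a set),
`res_E = galoisCohomology.res (W.torsionGaloisModule (p^m)) E 1` and `(E[p^m] → E(K̄_E))_* =
galoisCohomology.map (W.torsionPointsMapIntertwining (p^m) E) 1` (kernel = the local Kummer
condition). All four maps are maps of compatible pairs; both sides are `[pointsMap ∘ φ ∘ res]` on the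
subgroup. [cite: GreenbergLNM1716, §3 p. 86 (the commutative diagram)] -/
theorem localResOver_levelToLayerZero
    (c : galoisCohomology (W.torsionGaloisModule ((p ^ m : ℕ) : ℤ)) 1) :
    W.localResOver p (κ.layerSubgroup 0) E
        (resH1Hom (subgroupIncl (κ.layerSubgroup 0)) (AddMonoidHom.id (geomPrimaryTorsion W p))
          (fun _ _ ↦ rfl) (galoisCohomology.map (primaryInclusion W p m) 1 c)) =
      resH1Hom (subgroupIncl (localSubgroup (κ.layerSubgroup 0) E))
        (AddMonoidHom.id (localPoints W E)) (fun _ _ ↦ rfl)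
        (galoisCohomology.map (W.torsionPointsMapIntertwining ((p ^ m : ℕ) : ℤ) E) 1
          (galoisCohomology.res (W.torsionGaloisModule ((p ^ m : ℕ) : ℤ)) E 1 c)) := by
  rw [localResOver_layerZero_resH1Hom_subgroupIncl, resH1Hom_pointsMap_map_primaryInclusion,
    map_res_torsionGaloisModule_apply]

end Local

/-! ### §3 The level-`∞` local condition read at level `m` -/

section Tower

variable {K : Type u} [Field K] (W : WeierstrassCurve K) (p : ℕ) [hp : Fact p.Prime]
  (κ : ZpExtension K p) (m : ℕ) (E : Type u) [Field E] [Algebra K E]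

/-- For any `z ∈ H¹(K_0, E[p^∞])`: `h_0 z` dies in `H¹(H_{E,∞}, E(K̄_E))` iff `loc_{E,0} z` lies in
the local tower kernel `𝒦_{E,0} = ker (H¹(H_{E,0}, E(K̄_E)) → H¹(H_{E,∞}, E(K̄_E)))` (restriction
commutes with the local restrictions, `localResOverOfEmb_resOfLe`).
[cite: GreenbergLNM1716, §3 p. 86 (the commutative diagram)] -/
theorem layerToInfty_zero_mem_localKerOver_iff (z : W.subgroupH1 p (κ.layerSubgroup 0)) :
    W.layerToInfty κ 0 z ∈ W.localKerOver p κ.kerSubgroup E ↔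
      W.localResOver p (κ.layerSubgroup 0) E z ∈ W.localTowerKer κ E 0 := by
  rw [mem_localKerOver_iff, mem_localTowerKer_iff]
  change W.localResOverOfEmb p κ.kerSubgroup (closureEmb (K := K) E)
      (W.resOfLe p (κ.kerSubgroup_le_layerSubgroup 0) z) = 0 ↔ _
  rw [W.localResOverOfEmb_resOfLe p (closureEmb (K := K) E) (κ.kerSubgroup_le_layerSubgroup 0) z]
  exact Iff.rfl

/-- **The tower condition at level `m`.** For `c ∈ H¹(K, E[p^m])`: `h_0 (Ψ_m c)` dies in
`H¹(H_{E,∞}, E(K̄_E))` (the level-`∞` local condition at the prime of `K_∞` singled out by the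
chosen embedding) iff `θ_E (res_E c) ∈ 𝒦_{E,0}`. [cite: GreenbergLNM1716, §3 p. 86] -/
theorem layerToInfty_levelToLayerZero_mem_localKerOver_iff
    (c : galoisCohomology (W.torsionGaloisModule ((p ^ m : ℕ) : ℤ)) 1) :
    W.layerToInfty κ 0 (resH1Hom (subgroupIncl (κ.layerSubgroup 0))
        (AddMonoidHom.id (geomPrimaryTorsion W p)) (fun _ _ ↦ rfl)
        (galoisCohomology.map (primaryInclusion W p m) 1 c)) ∈ W.localKerOver p κ.kerSubgroup E ↔
      resH1Hom (subgroupIncl (localSubgroup (κ.layerSubgroup 0) E))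
          (AddMonoidHom.id (localPoints W E)) (fun _ _ ↦ rfl)
          (galoisCohomology.map (W.torsionPointsMapIntertwining ((p ^ m : ℕ) : ℤ) E) 1
            (galoisCohomology.res (W.torsionGaloisModule ((p ^ m : ℕ) : ℤ)) E 1 c)) ∈
        W.localTowerKer κ E 0 := by
  rw [layerToInfty_zero_mem_localKerOver_iff, localResOver_levelToLayerZero]

/-- **Kummer ⟹ tower.** A local class in the Kummer condition `𝓚_E = ker (H¹(Γ_E, E[p^m]) →
H¹(Γ_E, E(K̄_E)))` has `θ_E x = 0`, hence lies in (the preimage of) every subgroup, in particular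
of `𝒦_{E,0}`. [folklore] -/
theorem resH1Hom_map_eq_zero_of_mem_kummerLocalConditionAt
    {x : galoisCohomology (GaloisRep.restrictField E (W.torsionGaloisModule ((p ^ m : ℕ) : ℤ))) 1}
    (hx : x ∈ W.kummerLocalConditionAt ((p ^ m : ℕ) : ℤ) E) :
    resH1Hom (subgroupIncl (localSubgroup (κ.layerSubgroup 0) E))
        (AddMonoidHom.id (localPoints W E)) (fun _ _ ↦ rfl)
        (galoisCohomology.map (W.torsionPointsMapIntertwining ((p ^ m : ℕ) : ℤ) E) 1 x) = 0 := by
  rw [(W.mem_kummerLocalConditionAt_iff _ E x).mp hx]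
  exact map_zero _

/-- Every element of `Γ_E` lies in `H_{E,0} = (Γ_E → Γ_K)⁻¹(κ⁻¹ℤ_p)`. [folklore] -/
theorem mem_localSubgroup_layerSubgroup_zero (τ : absoluteGaloisGroup E) :
    τ ∈ localSubgroup (κ.layerSubgroup 0) E :=
  (mem_localSubgroup_iff _ _ τ).mpr (mem_layerSubgroup_zero p κ _)

/-- `θ_E x = 0 ⟹ x ∈ 𝓚_E`: restriction to the subgroup `H_{E,0}` (all of `Γ_E`) is injective
(`bijective_resH1Hom_subgroupIncl`). [folklore] -/
theorem mem_kummerLocalConditionAt_of_resH1Hom_map_eq_zero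
    {x : galoisCohomology (GaloisRep.restrictField E (W.torsionGaloisModule ((p ^ m : ℕ) : ℤ))) 1}
    (hx : resH1Hom (subgroupIncl (localSubgroup (κ.layerSubgroup 0) E))
        (AddMonoidHom.id (localPoints W E)) (fun _ _ ↦ rfl)
        (galoisCohomology.map (W.torsionPointsMapIntertwining ((p ^ m : ℕ) : ℤ) E) 1 x) = 0) :
    x ∈ W.kummerLocalConditionAt ((p ^ m : ℕ) : ℤ) E := by
  rw [W.mem_kummerLocalConditionAt_iff]
  apply (bijective_resH1Hom_subgroupIncl (localPoints W E) (localSubgroup (κ.layerSubgroup 0) E)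
    (mem_localSubgroup_layerSubgroup_zero p κ E)).injective
  rw [hx]
  exact (map_zero _).symm

omit hp in
/-- Classes of `H¹(Γ_E, E[p^m])` (restricted module) are killed by `p^m`. [folklore] -/
theorem pow_smul_galoisCohomology_restrictField_torsion_eq_zero
    (x : galoisCohomology (GaloisRep.restrictField E (W.torsionGaloisModule ((p ^ m : ℕ) : ℤ))) 1) :
    p ^ m • x = 0 :=
  galoisCohomology.nsmul_eq_zero_of_forall _ (pow_nsmul_geomTorsion_eq_zero W p m) x

/-- **Tower ⟹ Kummer where `𝒦_{E,0}[p^∞] = 0`.** If the `p`-power torsion of the local tower kernel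
at `E` vanishes (`W.localTowerKerPrimary κ E 0 = ⊥`: at `v ∤ p` with `p ∤ c_v`, B4
`#𝒦_{v,0}[p^∞] = p^{ord_p c_v}`; at archimedean `w`), then `θ_E x ∈ 𝒦_{E,0}` forces `x ∈ 𝓚_E`:
`θ_E x` is `p^m`-torsion, hence zero, and restriction to `H_{E,0}` is injective.
[cite: GreenbergLNM1716, §3 pp. 86–88] -/
theorem mem_kummerLocalConditionAt_of_mem_localTowerKer
    (h0 : W.localTowerKerPrimary κ E 0 = ⊥)
    {x : galoisCohomology (GaloisRep.restrictField E (W.torsionGaloisModule ((p ^ m : ℕ) : ℤ))) 1}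
    (hx : resH1Hom (subgroupIncl (localSubgroup (κ.layerSubgroup 0) E))
        (AddMonoidHom.id (localPoints W E)) (fun _ _ ↦ rfl)
        (galoisCohomology.map (W.torsionPointsMapIntertwining ((p ^ m : ℕ) : ℤ) E) 1 x) ∈
      W.localTowerKer κ E 0) :
    x ∈ W.kummerLocalConditionAt ((p ^ m : ℕ) : ℤ) E := by
  apply mem_kummerLocalConditionAt_of_resH1Hom_map_eq_zero W p κ m E
  have hmem : resH1Hom (subgroupIncl (localSubgroup (κ.layerSubgroup 0) E))
        (AddMonoidHom.id (localPoints W E)) (fun _ _ ↦ rfl)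
        (galoisCohomology.map (W.torsionPointsMapIntertwining ((p ^ m : ℕ) : ℤ) E) 1 x) ∈
      W.localTowerKerPrimary κ E 0 := by
    rw [mem_localTowerKerPrimary_iff]
    refine ⟨hx, m, ?_⟩
    have h0 : p ^ m •
        galoisCohomology.map (W.torsionPointsMapIntertwining ((p ^ m : ℕ) : ℤ) E) 1 x = 0 := by
      rw [← map_nsmul, pow_smul_galoisCohomology_restrictField_torsion_eq_zero, map_zero]
    calc p ^ m • resH1Hom (subgroupIncl (localSubgroup (κ.layerSubgroup 0) E))
            (AddMonoidHom.id (localPoints W E)) (fun _ _ ↦ rfl)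
            (galoisCohomology.map (W.torsionPointsMapIntertwining ((p ^ m : ℕ) : ℤ) E) 1 x)
        = resH1Hom (subgroupIncl (localSubgroup (κ.layerSubgroup 0) E))
            (AddMonoidHom.id (localPoints W E)) (fun _ _ ↦ rfl)
            (p ^ m • galoisCohomology.map (W.torsionPointsMapIntertwining ((p ^ m : ℕ) : ℤ) E) 1 x) :=
          (map_nsmul _ _ _).symm
      _ = 0 := by rw [h0]; exact map_zero _
  rw [h0] at hmem
  exact (AddSubgroup.mem_bot).mp hmem

/-- Where `𝒦_{E,0}[p^∞] = 0`, the tower condition at level `m` IS the Kummer condition: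
`θ_E x ∈ 𝒦_{E,0} ↔ x ∈ 𝓚_E`. [cite: GreenbergLNM1716, §3 pp. 86–88] -/
theorem resH1Hom_map_mem_localTowerKer_iff_of_primary_eq_bot
    (h0 : W.localTowerKerPrimary κ E 0 = ⊥)
    (x : galoisCohomology (GaloisRep.restrictField E (W.torsionGaloisModule ((p ^ m : ℕ) : ℤ))) 1) :
    resH1Hom (subgroupIncl (localSubgroup (κ.layerSubgroup 0) E))
        (AddMonoidHom.id (localPoints W E)) (fun _ _ ↦ rfl)
        (galoisCohomology.map (W.torsionPointsMapIntertwining ((p ^ m : ℕ) : ℤ) E) 1 x) ∈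
      W.localTowerKer κ E 0 ↔ x ∈ W.kummerLocalConditionAt ((p ^ m : ℕ) : ℤ) E :=
  ⟨mem_kummerLocalConditionAt_of_mem_localTowerKer W p κ m E h0, fun hx ↦ by
    rw [resH1Hom_map_eq_zero_of_mem_kummerLocalConditionAt W p κ m E hx]; exact zero_mem _⟩

/-- **Archimedean places: the tower condition is the Kummer condition** (every infinite place
splits completely in a `ℤ_p`-extension, so `𝒦_{w,0} = 0`:
`ZpExtension.resGal_infinitePlace_mem_kerSubgroup`, `localTowerKer_eq_bot_of_forall_mem`).
[cite: GreenbergLNM1716, §3 p. 86] -/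
theorem resH1Hom_map_mem_localTowerKer_iff_infinitePlace [NumberField K] (w : InfinitePlace K)
    (x : galoisCohomology
      (GaloisRep.restrictField w.Completion (W.torsionGaloisModule ((p ^ m : ℕ) : ℤ))) 1) :
    resH1Hom (subgroupIncl (localSubgroup (κ.layerSubgroup 0) w.Completion))
        (AddMonoidHom.id (localPoints W w.Completion)) (fun _ _ ↦ rfl)
        (galoisCohomology.map (W.torsionPointsMapIntertwining ((p ^ m : ℕ) : ℤ) w.Completion) 1 x) ∈
      W.localTowerKer κ w.Completion 0 ↔ x ∈ W.kummerLocalConditionAt ((p ^ m : ℕ) : ℤ) w.Completion := by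
  have h : W.localTowerKer κ w.Completion 0 = ⊥ :=
    W.localTowerKer_eq_bot_of_forall_mem κ w.Completion 0
      (ZpExtension.resGal_infinitePlace_mem_kerSubgroup κ w)
  rw [h, AddSubgroup.mem_bot]
  exact ⟨mem_kummerLocalConditionAt_of_resH1Hom_map_eq_zero W p κ m w.Completion, fun hx ↦
    resH1Hom_map_eq_zero_of_mem_kummerLocalConditionAt W p κ m w.Completion hx⟩

end Tower

/-! ### §4 `Ψ_m c ∈ A_0` read place by place on `H¹(K, E[p^m])` -/

section Global

variable {K : Type u} [Field K] [NumberField K] (W : WeierstrassCurve K) (p : ℕ) [hp : Fact p.Prime]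
  (κ : ZpExtension K p) (m : ℕ)

/-- **`Ψ_m c ∈ A_0 = h_0⁻¹(Sel_{p^∞}(E/K_∞))` iff the tower condition holds at every place**:
`θ_v (loc_v c) ∈ 𝒦_{v,0}` for every finite `v` (with `loc_v = galoisCohomology.localization … (inr v)`)
and for every infinite `w` (one decomposition group per place, n1011
`mem_selmerInftyPreimage_zero_iff`; then §3). [cite: GreenbergLNM1716, §3 pp. 85–86] -/
theorem levelToLayerZero_mem_selmerInftyPreimage_iff
    (c : galoisCohomology (W.torsionGaloisModule ((p ^ m : ℕ) : ℤ)) 1) :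
    resH1Hom (subgroupIncl (κ.layerSubgroup 0)) (AddMonoidHom.id (geomPrimaryTorsion W p))
        (fun _ _ ↦ rfl) (galoisCohomology.map (primaryInclusion W p m) 1 c) ∈
        W.selmerInftyPreimage κ 0 ↔
      (∀ v : HeightOneSpectrum (𝓞 K),
        resH1Hom (subgroupIncl (localSubgroup (κ.layerSubgroup 0) (v.adicCompletion K)))
            (AddMonoidHom.id (localPoints W (v.adicCompletion K))) (fun _ _ ↦ rfl)
            (galoisCohomology.map
              (W.torsionPointsMapIntertwining ((p ^ m : ℕ) : ℤ) (v.adicCompletion K)) 1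
              (galoisCohomology.localization (W.torsionGaloisModule ((p ^ m : ℕ) : ℤ))
                (Sum.inr v) 1 c)) ∈
          W.localTowerKer κ (v.adicCompletion K) 0) ∧
      ∀ w : InfinitePlace K,
        resH1Hom (subgroupIncl (localSubgroup (κ.layerSubgroup 0) w.Completion))
            (AddMonoidHom.id (localPoints W w.Completion)) (fun _ _ ↦ rfl)
            (galoisCohomology.map
              (W.torsionPointsMapIntertwining ((p ^ m : ℕ) : ℤ) w.Completion) 1
              (galoisCohomology.localization (W.torsionGaloisModule ((p ^ m : ℕ) : ℤ))
                (Sum.inl w) 1 c)) ∈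
          W.localTowerKer κ w.Completion 0 := by
  rw [mem_selmerInftyPreimage_zero_iff]
  refine and_congr (forall_congr' fun v ↦ ?_) (forall_congr' fun w ↦ ?_)
  · exact layerToInfty_levelToLayerZero_mem_localKerOver_iff W p κ m (v.adicCompletion K) c
  · exact layerToInfty_levelToLayerZero_mem_localKerOver_iff W p κ m w.Completion c

/-- The same with the archimedean conditions in KUMMER form: **`Ψ_m c ∈ A_0` iff `θ_v (loc_v c) ∈
𝒦_{v,0}` at every finite place and `loc_w c ∈ 𝓚_w` (the Kummer Selmer structure
`W.kummerSelmerStructure (p^m) (inl w)`) at every infinite place.**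
[cite: GreenbergLNM1716, §3 pp. 85–86] -/
theorem levelToLayerZero_mem_selmerInftyPreimage_iff'
    (c : galoisCohomology (W.torsionGaloisModule ((p ^ m : ℕ) : ℤ)) 1) :
    resH1Hom (subgroupIncl (κ.layerSubgroup 0)) (AddMonoidHom.id (geomPrimaryTorsion W p))
        (fun _ _ ↦ rfl) (galoisCohomology.map (primaryInclusion W p m) 1 c) ∈
        W.selmerInftyPreimage κ 0 ↔
      (∀ v : HeightOneSpectrum (𝓞 K),
        resH1Hom (subgroupIncl (localSubgroup (κ.layerSubgroup 0) (v.adicCompletion K)))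
            (AddMonoidHom.id (localPoints W (v.adicCompletion K))) (fun _ _ ↦ rfl)
            (galoisCohomology.map
              (W.torsionPointsMapIntertwining ((p ^ m : ℕ) : ℤ) (v.adicCompletion K)) 1
              (galoisCohomology.localization (W.torsionGaloisModule ((p ^ m : ℕ) : ℤ))
                (Sum.inr v) 1 c)) ∈
          W.localTowerKer κ (v.adicCompletion K) 0) ∧
      ∀ w : InfinitePlace K,
        galoisCohomology.localization (W.torsionGaloisModule ((p ^ m : ℕ) : ℤ)) (Sum.inl w) 1 c ∈
          W.kummerSelmerStructure ((p ^ m : ℕ) : ℤ) (Sum.inl w) := by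
  rw [levelToLayerZero_mem_selmerInftyPreimage_iff]
  refine and_congr Iff.rfl (forall_congr' fun w ↦ ?_)
  rw [kummerSelmerStructure_apply]
  exact resH1Hom_map_mem_localTowerKer_iff_infinitePlace W p κ m w _

end Global

end Summit.BirchSwinnertonDyer.Rank1Residual.Additive.LevelBridge

end
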